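import Summits.KontsevichZagierPeriods.KontsevichZagierPeriods.Theorems.TerasomaMultiplicationBetaCancellationEulerIntervals
import Summits.KontsevichZagierPeriods.KontsevichZagierPeriods.Theorems.TerasomaMultiplicationBetaCancellationStubMoebiusMove
import Literature.NumberTheory.Transcendental.GammaMonomialsProofs

/-!
# Euler reflection inside the calculus (item stmt-KontsevichZagierPeriods-3383) — angles and the Möbius reduction

Lead's glue, part 2 (line `dirichlet-companion-to-pi` of crux stmt-KontsevichZagierPeriods-13633):
algebraicity of `cos/sin/tan (πk/n)`, the tangent bookkeeping of the Möbius rotations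
`t ↦ (ct − s)/(st + c)`, the arctan-type representations `[(u,v), κ/(1+t²)]`, and
`arctan_reduce`: an arctan representation on `(tan φ₀, tan φ_N)` with `φ_i = π(k₀+2i)/(4q)` is
`N` copies of the fundamental piece `[(0, tan(π/2q)), κ/(1+t²)]` modulo relations
(subdivision + one `stub_moebiusMove` per piece).
-/

noncomputable section

-- `Summit.KontsevichZagierPeriods.KontsevichZagierPeriods.…` is the tree's mandated layout (single-conjunct summit).
set_option linter.dupNamespace false

namespace Summit.KontsevichZagierPeriods.KontsevichZagierPeriods.BetaCancellationLine

open MeasureTheory Set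
open Literature.NumberTheory.Transcendental
open Literature.NumberTheory.Transcendental.KZ
open Literature.ModelTheory.ExponentialFields (IsSemialgebraic isSemialgebraic_univ)
open MvPolynomial (aeval X C)
open Summit.KontsevichZagierPeriods.KontsevichZagierPeriods.BetaCancellationNegative

/-! ## Angles `kπ/(4q)`: algebraicity and tangent bookkeeping -/

/-- `cos (π k / n)` is algebraic for every integer `k` and `n > 0`. [folklore] -/
theorem isAlgebraic_cos_int_mul_pi_div (k : ℤ) {n : ℕ} (hn : 0 < n) :
    IsAlgebraic ℚ (Real.cos (Real.pi * k / n)) := by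
  rcases le_or_gt 0 k with hk | hk
  · have h := KoblitzOgus.isAlgebraic_cos_rat_mul_pi k.toNat hn
    have hc : ((k.toNat : ℕ) : ℝ) = (k : ℝ) := by exact_mod_cast Int.toNat_of_nonneg hk
    rwa [hc] at h
  · have h := KoblitzOgus.isAlgebraic_cos_rat_mul_pi (-k).toNat hn
    have hc : (((-k).toNat : ℕ) : ℝ) = -(k : ℝ) := by
      have := Int.toNat_of_nonneg (neg_nonneg.2 hk.le); exact_mod_cast this
    rw [hc] at h
    have : Real.pi * -(k:ℝ) / n = -(Real.pi * k / n) := by ring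
    rwa [this, Real.cos_neg] at h

/-- `sin (π k / n)` is algebraic for every integer `k` and `n > 0`. [folklore] -/
theorem isAlgebraic_sin_int_mul_pi_div (k : ℤ) {n : ℕ} (hn : 0 < n) :
    IsAlgebraic ℚ (Real.sin (Real.pi * k / n)) := by
  rcases le_or_gt 0 k with hk | hk
  · have h := KoblitzOgus.isAlgebraic_sin_rat_mul_pi k.toNat hn
    have hc : ((k.toNat : ℕ) : ℝ) = (k : ℝ) := by exact_mod_cast Int.toNat_of_nonneg hk
    rwa [hc] at h
  · have h := KoblitzOgus.isAlgebraic_sin_rat_mul_pi (-k).toNat hn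
    have hc : (((-k).toNat : ℕ) : ℝ) = -(k : ℝ) := by
      have := Int.toNat_of_nonneg (neg_nonneg.2 hk.le); exact_mod_cast this
    rw [hc] at h
    have : Real.pi * -(k:ℝ) / n = -(Real.pi * k / n) := by ring
    rw [this, Real.sin_neg] at h
    simpa using h.neg

/-- `tan (π k / n)` is algebraic for every integer `k` and `n > 0`. [folklore] -/
theorem isAlgebraic_tan_int_mul_pi_div (k : ℤ) {n : ℕ} (hn : 0 < n) :
    IsAlgebraic ℚ (Real.tan (Real.pi * k / n)) := by
  rw [Real.tan_eq_sin_div_cos]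
  exact (isAlgebraic_sin_int_mul_pi_div k hn).mul (isAlgebraic_cos_int_mul_pi_div k hn).inv

/-- The Möbius image of `tan φ` under the rotation by `−φ` is `0`. [folklore] -/
theorem moebius_tan_self {φ : ℝ} (hc : Real.cos φ ≠ 0) :
    (Real.cos φ * Real.tan φ - Real.sin φ) / (Real.sin φ * Real.tan φ + Real.cos φ) = 0 := by
  rw [Real.tan_eq_sin_div_cos]
  have : Real.cos φ * (Real.sin φ / Real.cos φ) - Real.sin φ = 0 := by field_simp; ring
  rw [this, zero_div]

/-- The denominator of the Möbius map at `tan φ`. [folklore] -/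
theorem moebius_den_tan_self {φ : ℝ} (hc : Real.cos φ ≠ 0) :
    Real.sin φ * Real.tan φ + Real.cos φ = (Real.cos φ)⁻¹ := by
  rw [Real.tan_eq_sin_div_cos]
  field_simp
  nlinarith [Real.sin_sq_add_cos_sq φ]

/-- The denominator of the Möbius map at `tan (φ + δ)`. [folklore] -/
theorem moebius_den_tan_add {φ δ : ℝ} (hc : Real.cos (φ + δ) ≠ 0) :
    Real.sin φ * Real.tan (φ + δ) + Real.cos φ = Real.cos δ / Real.cos (φ + δ) := by
  rw [Real.tan_eq_sin_div_cos]
  have h : Real.cos δ = Real.cos ((φ + δ) - φ) := by ring_nf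
  rw [h, Real.cos_sub]
  field_simp
  ring

/-- The Möbius image of `tan (φ + δ)` under the rotation by `−φ` is `tan δ`. [folklore] -/
theorem moebius_tan_add {φ δ : ℝ} (hcd : Real.cos (φ + δ) ≠ 0) (hd : Real.cos δ ≠ 0) :
    (Real.cos φ * Real.tan (φ + δ) - Real.sin φ) / (Real.sin φ * Real.tan (φ + δ) + Real.cos φ) =
      Real.tan δ := by
  rw [moebius_den_tan_add hcd, Real.tan_eq_sin_div_cos, Real.tan_eq_sin_div_cos]
  have hnum : Real.cos φ * (Real.sin (φ + δ) / Real.cos (φ + δ)) - Real.sin φ =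
      Real.sin δ / Real.cos (φ + δ) := by
    have h : Real.sin δ = Real.sin ((φ + δ) - φ) := by ring_nf
    rw [h, Real.sin_sub]
    field_simp
  rw [hnum]
  field_simp

/-- Positivity of the Möbius denominator on a piece `[tan φ, tan (φ+δ)]`. [folklore] -/
theorem moebius_den_pos {φ δ : ℝ} (hc : 0 < Real.cos φ) (hcd : 0 < Real.cos (φ + δ))
    (hd : 0 < Real.cos δ) :
    ∀ t ∈ Set.Icc (Real.tan φ) (Real.tan (φ + δ)), 0 < Real.sin φ * t + Real.cos φ := by
  intro t ht
  have hu : 0 < Real.sin φ * Real.tan φ + Real.cos φ := by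
    rw [moebius_den_tan_self hc.ne']; exact inv_pos.2 hc
  have hv : 0 < Real.sin φ * Real.tan (φ + δ) + Real.cos φ := by
    rw [moebius_den_tan_add hcd.ne']; exact div_pos hd hcd
  rcases le_or_gt 0 (Real.sin φ) with hs | hs
  · calc 0 < Real.sin φ * Real.tan φ + Real.cos φ := hu
      _ ≤ Real.sin φ * t + Real.cos φ := by nlinarith [ht.1]
  · calc 0 < Real.sin φ * Real.tan (φ + δ) + Real.cos φ := hv
      _ ≤ Real.sin φ * t + Real.cos φ := by nlinarith [ht.2]

/-- `−cos θ / sin θ = tan (θ − π/2)`. [folklore] -/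
theorem neg_cos_div_sin_eq_tan (θ : ℝ) : (0 - Real.cos θ) / Real.sin θ = Real.tan (θ - Real.pi / 2) := by
  rw [Real.tan_eq_sin_div_cos, Real.sin_sub_pi_div_two, Real.cos_sub_pi_div_two, zero_sub]

/-- `(1 − cos θ)/sin θ = tan (θ/2)` when `sin (θ/2) ≠ 0`, `cos (θ/2) ≠ 0`. [folklore] -/
theorem one_sub_cos_div_sin_eq_tan_half {θ : ℝ} (hs : Real.sin (θ / 2) ≠ 0) (hc : Real.cos (θ / 2) ≠ 0) :
    (1 - Real.cos θ) / Real.sin θ = Real.tan (θ / 2) := by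
  have h1 : Real.cos θ = 1 - 2 * Real.sin (θ / 2) ^ 2 := by
    rw [show θ = 2 * (θ / 2) by ring, Real.cos_two_mul, Real.cos_sq']; ring_nf
  have h2 : Real.sin θ = 2 * Real.sin (θ / 2) * Real.cos (θ / 2) := by
    rw [show θ = 2 * (θ / 2) by ring, Real.sin_two_mul]; ring_nf
  rw [h1, h2, Real.tan_eq_sin_div_cos]
  field_simp
  ring


/-! ## Arctan-type representations `[(u,v), κ/(1+t²)]` and their reduction by Möbius moves -/

/-- `t ↦ κ/(1+t²)` composed with the coordinate is `ℚ`-semialgebraic on every `ℚ`-semialgebraic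
set, for algebraic `κ`. [folklore] -/
theorem isSemialgebraicFunOn_arctanKernel {σ : Set (Fin 1 → ℝ)} (hσ : IsSemialgebraic ℚ σ) {κ : ℝ}
    (hκ : IsAlgebraic ℚ κ) : IsSemialgebraicFunOn ℚ σ (fun x => κ / (1 + (x 0) ^ 2)) := by
  have h1 : IsSemialgebraicFunOn ℚ σ (fun x : Fin 1 → ℝ =>
      aeval x (1 : MvPolynomial (Fin 1) ℚ) / aeval x (1 + X 0 ^ 2 : MvPolynomial (Fin 1) ℚ)) :=
    isSemialgebraicFunOn_aeval_div_aeval hσ 1 (1 + X 0 ^ 2) fun x _ => by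
      simp only [map_add, map_one, map_pow, MvPolynomial.aeval_X]; positivity
  refine (IsSemialgebraicFunOn.mul_holds (isSemialgebraicFunOn_const_of_isAlgebraic hσ hκ) h1).congr
    fun x _ => ?_
  simp only [Pi.mul_apply, map_add, map_one, map_pow, MvPolynomial.aeval_X]
  ring

/-- `κ/(1+t²)` is integrable on every interval. [folklore] -/
theorem integrableOn_arctanKernel (κ u v : ℝ) : IntegrableOn (fun t : ℝ => κ / (1 + t ^ 2)) (Set.Ioo u v) := by
  have h := (integrable_inv_one_add_sq.const_mul κ).integrableOn (s := Set.Ioo u v)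
  refine h.congr_fun (fun t _ => ?_) measurableSet_Ioo
  simp [div_eq_mul_inv]

/-- **The arctan-type representation** `[(u,v), κ/(1+t²)]` for algebraic `u, v, κ`. [folklore] -/
def arctanRep (u v κ : ℝ) (hu : IsAlgebraic ℚ u) (hv : IsAlgebraic ℚ v) (hκ : IsAlgebraic ℚ κ) :
    IntegralRep 1 :=
  intervalRep u v hu hv (fun t => κ / (1 + t ^ 2))
    (isSemialgebraicFunOn_arctanKernel (isSemialgebraic_Ioo1 hu hv) hκ) (integrableOn_arctanKernel κ u v)

/-- The domain of `arctanRep`. [folklore] -/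
@[simp] theorem arctanRep_domain (u v κ : ℝ) (hu : IsAlgebraic ℚ u) (hv : IsAlgebraic ℚ v)
    (hκ : IsAlgebraic ℚ κ) : (arctanRep u v κ hu hv hκ).domain = Ioo1 u v := rfl

/-- The integrand of `arctanRep`. [folklore] -/
@[simp] theorem arctanRep_integrand (u v κ : ℝ) (hu : IsAlgebraic ℚ u) (hv : IsAlgebraic ℚ v)
    (hκ : IsAlgebraic ℚ κ) : (arctanRep u v κ hu hv hκ).integrand = fun x => κ / (1 + (x 0) ^ 2) := rfl

/-- The angles `π k/(4q)`. [folklore] -/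
def ang (q : ℕ) (k : ℤ) : ℝ := Real.pi * k / (4 * q)

/-- `ang q k` as `π · k / (4q : ℕ)`. [folklore] -/
theorem ang_eq_div_natCast (q : ℕ) (k : ℤ) : ang q k = Real.pi * k / ((4 * q : ℕ) : ℝ) := by
  simp [ang]

/-- One step of the subdivision is `δ = π/(2q)`. [folklore] -/
theorem ang_add_two {q : ℕ} (hq : 0 < q) (k : ℤ) : ang q (k + 2) = ang q k + Real.pi / (2 * q) := by
  have hq' : (q:ℝ) ≠ 0 := by exact_mod_cast hq.ne'
  simp only [ang, Int.cast_add, Int.cast_ofNat]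
  field_simp
  ring

/-- `ang` is strictly increasing in `k`. [folklore] -/
theorem ang_lt_ang {q : ℕ} (hq : 0 < q) {k l : ℤ} (h : k < l) : ang q k < ang q l := by
  have hq' : (0:ℝ) < 4 * q := by positivity
  have h' : (k:ℝ) < l := by exact_mod_cast h
  exact div_lt_div_of_pos_right (mul_lt_mul_of_pos_left h' Real.pi_pos) hq'

/-- `ang q k ∈ (−π/2, π/2)` for `−2q < k < 2q`. [folklore] -/
theorem ang_mem_Ioo {q : ℕ} (hq : 0 < q) {k : ℤ} (hlo : -(2 * q : ℤ) < k) (hhi : k < 2 * q) :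
    ang q k ∈ Set.Ioo (-(Real.pi / 2)) (Real.pi / 2) := by
  have e1 : ang q (-(2 * q : ℤ)) = -(Real.pi / 2) := by
    have hq' : (q:ℝ) ≠ 0 := by exact_mod_cast hq.ne'
    simp only [ang, Int.cast_neg, Int.cast_mul, Int.cast_ofNat, Int.cast_natCast]
    field_simp
    ring
  have e2 : ang q (2 * q : ℤ) = Real.pi / 2 := by
    have hq' : (q:ℝ) ≠ 0 := by exact_mod_cast hq.ne'
    simp only [ang, Int.cast_mul, Int.cast_ofNat, Int.cast_natCast]
    field_simp
    ring
  exact ⟨e1 ▸ ang_lt_ang hq hlo, e2 ▸ ang_lt_ang hq hhi⟩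

/-- `cos (ang q k) > 0` for `−2q < k < 2q`. [folklore] -/
theorem cos_ang_pos {q : ℕ} (hq : 0 < q) {k : ℤ} (hlo : -(2 * q : ℤ) < k) (hhi : k < 2 * q) :
    0 < Real.cos (ang q k) :=
  Real.cos_pos_of_mem_Ioo (ang_mem_Ioo hq hlo hhi)

/-- `cos (π/(2q)) > 0` for `q ≥ 2`. [folklore] -/
theorem cos_step_pos {q : ℕ} (hq : 1 < q) : 0 < Real.cos (Real.pi / (2 * q)) := by
  have h1 : (2:ℝ) ≤ q := by exact_mod_cast hq
  refine Real.cos_pos_of_mem_Ioo ⟨?_, ?_⟩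
  · have : 0 < Real.pi / (2 * q) := by positivity
    linarith [Real.pi_pos]
  · rw [div_lt_div_iff_of_pos_left Real.pi_pos (by positivity) (by norm_num)]
    nlinarith

/-- `tan (π/(2q))` in the `ang` spelling. [folklore] -/
theorem tan_step_eq {q : ℕ} (hq : 0 < q) : Real.pi / (2 * q) = ang q 2 := by
  have := ang_add_two hq 0
  simp only [zero_add] at this
  rw [this]
  simp [ang]

/-- `tan (ang q k)` is algebraic. [folklore] -/
theorem isAlgebraic_tan_ang {q : ℕ} (hq : 0 < q) (k : ℤ) : IsAlgebraic ℚ (Real.tan (ang q k)) := by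
  rw [ang_eq_div_natCast]
  exact isAlgebraic_tan_int_mul_pi_div k (by positivity)

/-- `cos (ang q k)` is algebraic. [folklore] -/
theorem isAlgebraic_cos_ang {q : ℕ} (hq : 0 < q) (k : ℤ) : IsAlgebraic ℚ (Real.cos (ang q k)) := by
  rw [ang_eq_div_natCast]
  exact isAlgebraic_cos_int_mul_pi_div k (by positivity)

/-- `sin (ang q k)` is algebraic. [folklore] -/
theorem isAlgebraic_sin_ang {q : ℕ} (hq : 0 < q) (k : ℤ) : IsAlgebraic ℚ (Real.sin (ang q k)) := by
  rw [ang_eq_div_natCast]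
  exact isAlgebraic_sin_int_mul_pi_div k (by positivity)

/-- **Möbius reduction of an arctan-type representation**: if `A = [(tan φ₀, tan φ_N), κ/(1+t²)]`
with `φ_i = π(k₀ + 2i)/(4q)` inside `(−π/2, π/2)`, then `[A] − N·[Z] ∈ relations` for
`Z = [(0, tan(π/(2q))), κ/(1+t²)]`: subdivide at the `tan φ_i` and rotate each piece by `−φ_i`
(`stub_moebiusMove`). [folklore] -/
theorem arctan_reduce {q : ℕ} (hq : 0 < q) (hq1 : 1 < q) {κ : ℝ} (hκ : IsAlgebraic ℚ κ) (k₀ : ℤ)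
    (N : ℕ) (hlo : -(2 * q : ℤ) < k₀) (hhi : k₀ + 2 * N < 2 * q) (A Z : IntegralRep 1)
    (hA : A.domain = Ioo1 (Real.tan (ang q k₀)) (Real.tan (ang q (k₀ + 2 * N))))
    (hAi : Set.EqOn A.integrand (fun x => κ / (1 + (x 0) ^ 2)) A.domain)
    (hZ : Z.domain = Ioo1 0 (Real.tan (Real.pi / (2 * q))))
    (hZi : Set.EqOn Z.integrand (fun x => κ / (1 + (x 0) ^ 2)) Z.domain) :
    of A - N • of Z ∈ relations := by
  classical
  -- the division points
  set w : ℕ → ℝ := fun i => Real.tan (ang q (k₀ + 2 * i)) with hw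
  have hang_succ : ∀ i : ℕ, ang q (k₀ + 2 * (i + 1 : ℕ)) = ang q (k₀ + 2 * i) + Real.pi / (2 * q) := by
    intro i
    rw [← ang_add_two hq]
    congr 1
    push_cast
    ring
  have hmem : ∀ i : ℕ, i ≤ N → ang q (k₀ + 2 * i) ∈ Set.Ioo (-(Real.pi / 2)) (Real.pi / 2) := by
    intro i hi
    refine ang_mem_Ioo hq (by omega) (by omega)
  have hwlt : ∀ i < N, w i < w (i + 1) := by
    intro i hi
    simp only [hw]
    refine Real.strictMonoOn_tan (hmem i hi.le) ?_ (ang_lt_ang hq (by push_cast; omega))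
    have := hmem (i + 1) hi
    exact_mod_cast this
  have hwalg : ∀ i ≤ N, IsAlgebraic ℚ (w i) := fun i _ => isAlgebraic_tan_ang hq _
  -- the pieces
  have hA' : A.domain = Ioo1 (w 0) (w N) := by simp [hw, hA]
  have hsubA : ∀ i < N, Ioo1 (w i) (w (i + 1)) ⊆ A.domain := by
    intro i hi x hx
    rw [hA']
    have h0i : w 0 ≤ w i := by
      rcases Nat.eq_zero_or_pos i with rfl | hi0
      · exact le_rfl
      · exact (lt_of_forall_lt_succ hwlt hi0 hi.le).le
    have hiN : w (i + 1) ≤ w N := by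
      rcases (Nat.succ_le_of_lt hi).lt_or_eq with hlt | heq
      · exact (lt_of_forall_lt_succ hwlt hlt le_rfl).le
      · exact le_of_eq (congrArg w heq)
    exact ⟨lt_of_le_of_lt h0i hx.1, lt_of_lt_of_le hx.2 hiN⟩
  let piece : ℕ → IntegralRep 1 := fun i =>
    if hi : i < N then A.restrict (Ioo1 (w i) (w (i + 1)))
      (isSemialgebraic_Ioo1 (hwalg i hi.le) (hwalg (i + 1) hi)) (hsubA i hi) else A
  have hpd : ∀ i < N, (piece i).domain = Ioo1 (w i) (w (i + 1)) := by
    intro i hi; simp [piece, hi]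
  have hpi : ∀ i < N, Set.EqOn (piece i).integrand A.integrand (piece i).domain := by
    intro i hi x _; simp [piece, hi]
  have hsplit := of_sub_sum_pieces_mem_relations_aux N w hwalg hwlt A hA' piece hpd hpi
  -- each piece is moved onto `Z`
  have hpiece : ∀ i < N, of (piece i) - of Z ∈ relations := by
    intro i hi
    have hci : 0 < Real.cos (ang q (k₀ + 2 * i)) := Real.cos_pos_of_mem_Ioo (hmem i hi.le)
    have hci1 : 0 < Real.cos (ang q (k₀ + 2 * i) + Real.pi / (2 * q)) := by
      rw [← hang_succ]; exact Real.cos_pos_of_mem_Ioo (hmem (i + 1) hi)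
    have hcs : Real.cos (ang q (k₀ + 2 * i)) ^ 2 + Real.sin (ang q (k₀ + 2 * i)) ^ 2 = 1 := by
      rw [add_comm]; exact Real.sin_sq_add_cos_sq _
    refine stub_moebiusMove (Real.cos (ang q (k₀ + 2 * i))) (Real.sin (ang q (k₀ + 2 * i))) κ
      (isAlgebraic_cos_ang hq _) (isAlgebraic_sin_ang hq _) hκ hcs (w i) (w (i + 1)) (hwlt i hi)
      ?_ (piece i) Z (hpd i hi) (fun x hx => ?_) ?_ hZi
    · -- no pole on the piece
      have h := moebius_den_pos hci hci1 (cos_step_pos hq1)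
      simp only [hw, hang_succ]
      exact h
    · rw [hpi i hi hx]
      have hx' : x ∈ A.domain := hsubA i hi (by rwa [hpd i hi] at hx)
      exact hAi hx'
    · rw [hZ]
      simp only [hw, hang_succ, moebius_tan_self hci.ne',
        moebius_tan_add hci1.ne' (cos_step_pos hq1).ne']
      rfl
  -- sum up
  have hsum : ∑ i ∈ Finset.range N, of (piece i) - N • of Z ∈ relations := by
    have : ∑ i ∈ Finset.range N, of (piece i) - N • of Z =
        ∑ i ∈ Finset.range N, (of (piece i) - of Z) := by
      rw [Finset.sum_sub_distrib]
      simp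
    rw [this]
    exact AddSubgroup.sum_mem _ fun i hi => hpiece i (Finset.mem_range.1 hi)
  have := relations.add_mem hsplit hsum
  convert this using 1
  abel


/-- Registered helper statement of this file (for the `--supports` match): `cos (π/(2q)) > 0` for
`q ≥ 2`. [folklore] -/
theorem eulerAngles_cos_step_pos : ∀ (q : ℕ), 1 < q → 0 < Real.cos (Real.pi / (2 * q)) :=
  fun _ hq => cos_step_pos hq

end Summit.KontsevichZagierPeriods.KontsevichZagierPeriods.BetaCancellationLine
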